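import Literature.AlgebraicTopology.CharacteristicClasses.LineThomClassLocal
import Literature.AlgebraicTopology.SingularHomology.CohomologyMayerVietorisExtend
import Literature.AlgebraicTopology.SingularHomology.CohomologyDisjointOpenCover
import HarnessLib

/-!
# Gluing normalised (Thom) classes of a line bundle over unions of open sets

Continuation of `LineThomClassLocal` (Husemoller, *Fibre Bundles*, Ch. 17 §2–§3; Milnor–Stasheff
§10, proof of Thm. 10.4: "the Thom class exists and is unique for bundles of finite type by
Mayer–Vietoris induction; compatible classes on the pieces glue"). For the projective completion
`D = P(λ ⊕ ℂ)` of a complex LINE bundle and NORMALISED classes (`IsNormalised`: killed by the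
section at infinity, the canonical generator on each fibre) we prove:

* `IsNormalised.renormalise` — a class with the right fibre restrictions becomes normalised after
  subtracting `π^* s_∞^*` of itself (`renormalise`), without changing it where it already was
  normalised (`map_complPreimageIncl_renormalise`);
* `IsUniq S` — "normalised classes over `S` are unique"; it holds over trivialisable `S`
  (`isUniq_of_subset_baseSet`, from `LineThomClassLocal`) and over DISJOINT OPEN UNIONS of such
  (`isUniq_iUnion`, additivity `CohomologyDisjointOpenCover`);
* **`exists_isNormalised_union`** — two normalised classes over open `S₁`, `S₂` with `S₁ ∩ S₂` a
  uniqueness domain glue to a normalised class over `S₁ ∪ S₂` restricting to the given ones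
  (Mayer–Vietoris gluing `CohomologyMayerVietorisExtend.exists_of_map_inclusion_eq` + renormalisation);
* **`exists_isNormalised_iUnion`** — normalised classes over pairwise disjoint open `S_j` assemble to
  a normalised class over `⋃ S_j`.

Coefficients: a commutative ring `R` in the universe of the spaces (the form of the tree's
Mayer–Vietoris gluing), generator parameter `m ∈ R`. Everything is proved; no named facts.

## References

* J. Milnor, J. Stasheff, *Characteristic Classes*, PUP 1974, §10 (proof of Thm. 10.4). [MilnorStasheff1974]
* D. Husemoller, *Fibre Bundles*, GTM 20, Springer 1994, Ch. 17 §2–§3. [HusemollerFibreBundles1994]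
* A. Hatcher, *Algebraic Topology*, CUP 2002, §3.1 pp. 202–204 (additivity, Mayer–Vietoris). [HatcherAT2002]
-/

noncomputable section

open CategoryTheory Function Set Bundle Literature.AlgebraicTopology.SingularHomology
open scoped LinearAlgebra.Projectivization

universe u

namespace Literature.AlgebraicTopology.CharacteristicClasses

/-! ### Generalities: classes pulled back along constant maps; additivity along identified pieces -/

section General

variable (R : Type u) [CommRing R] (M : Type u) [AddCommGroup M] [Module R M]

/-- Elements of a zero object of `ModuleCat` vanish. [folklore] -/
private theorem eq_zero_of_isZero' {V : ModuleCat.{u} R} (h : Limits.IsZero V) (x : V) : x = 0 := by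
  have := congrArg (fun f : V ⟶ V ↦ f x) (h.eq_of_src (𝟙 V) 0)
  simpa using this

/-- **A positive-degree class pulled back along a constant map vanishes** (it factors through
`Hⁿ(pt) = 0`). [cite: HatcherAT2002, §3.1 p. 199] -/
theorem singularCohomology.map_const_eq_zero {X Y : Type u} [TopologicalSpace X] [TopologicalSpace Y]
    (y₀ : Y) {n : ℕ} (hn : n ≠ 0) (c : singularCohomology R M Y n) :
    singularCohomology.map R M (ContinuousMap.const X y₀) n c = 0 := by
  have hc : (ContinuousMap.const X y₀ : C(X, Y)) =
      (ContinuousMap.const PUnit.{u + 1} y₀).comp (ContinuousMap.const X PUnit.unit) := rfl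
  rw [hc, singularCohomology.map_comp, ModuleCat.comp_apply,
    eq_zero_of_isZero' R (singularCochainComplex.isZero_singularCohomology_of_subsingleton' (R := R) (M := M)
      (X := PUnit.{u + 1}) hn) (singularCohomology.map R M (ContinuousMap.const PUnit.{u + 1} y₀) n c), map_zero]

variable {X : Type u} [TopologicalSpace X] {J : Type*} {A : J → Set X} (hA : IsClopenPartition A)
  {Y : J → Type u} [∀ j, TopologicalSpace (Y j)] (θ : ∀ j, Y j ≃ₜ ↥(A j)) (g : ∀ j, C(Y j, X))
  (hg : ∀ j, (subsetIncl (A j)).comp (θ j : C(Y j, ↥(A j))) = g j)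
include hA hg

/-- **Additivity, pieces identified with other spaces — injectivity**: a class killed by all the
maps `g_j : Y_j ≅ A_j ⊆ X` of a clopen partition is zero. [cite: HatcherAT2002, §3.1 p. 202] -/
theorem eq_zero_of_forall_map_piece_eq_zero {n : ℕ} {x : singularCohomology R M X n}
    (h : ∀ j, singularCohomology.map R M (g j) n x = 0) : x = 0 := by
  refine singularCohomology.eq_zero_of_forall_map_subsetIncl_eq_zero hA fun j ↦ ?_
  apply (singularCohomology.mapIso R M (θ j) n).toLinearEquiv.injective
  change singularCohomology.map R M (θ j : C(Y j, ↥(A j))) n (singularCohomology.map R M (subsetIncl (A j)) n x) = _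
  rw [← ModuleCat.comp_apply, ← singularCohomology.map_comp, hg j, h j, map_zero]

/-- **Additivity, pieces identified with other spaces — surjectivity**: any family of classes on the
`Y_j ≅ A_j` is realised by a class on `X`. [cite: HatcherAT2002, §3.1 p. 202] -/
theorem exists_forall_map_piece_eq {n : ℕ} (y : ∀ j, singularCohomology R M (Y j) n) :
    ∃ x : singularCohomology R M X n, ∀ j, singularCohomology.map R M (g j) n x = y j := by
  obtain ⟨x, hx⟩ := singularCohomology.exists_forall_map_subsetIncl_eq hA
    fun j ↦ singularCohomology.map R M ((θ j).symm : C(↥(A j), Y j)) n (y j)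
  refine ⟨x, fun j ↦ ?_⟩
  rw [← hg j, singularCohomology.map_comp, ModuleCat.comp_apply, hx j, ← ModuleCat.comp_apply,
    ← singularCohomology.map_comp, Homeomorph.symm_comp_toContinuousMap, singularCohomology.map_id]
  rfl

end General

/-! ### The setting -/

section Setting

variable {B : Type u} [TopologicalSpace B] (F : Type u) [NormedAddCommGroup F] [NormedSpace ℂ F] [FiniteDimensional ℂ F]
  (E : B → Type u) [∀ b, AddCommGroup (E b)] [∀ b, Module ℂ (E b)]
  [TopologicalSpace (TotalSpace F E)] [∀ b, TopologicalSpace (E b)] [FiberBundle F E] [VectorBundle ℂ F E]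
  (hF : Module.finrank ℂ F = 1) (R : Type u) [CommRing R]

/-- The projection `P(λ ⊕ ℂ)|_S → S`. [folklore] -/
def complProjOn (S : Set B) : C(↥(complPreimage F E S), ↥S) where
  toFun p := ⟨p.1.proj, p.2⟩
  continuous_toFun := ((complProj F E).continuous.comp continuous_subtype_val).subtype_mk _

/-- `π ∘ s_∞ = 𝟙` over `S`. [folklore] -/
theorem complProjOn_comp_complInfOn (S : Set B) :
    (complProjOn F E S).comp (complInfOn F E hF S) = ContinuousMap.id ↥S := rfl

variable {F E} in
/-- `π ∘ (fibre over b) = const b`. [folklore] -/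
theorem complProjOn_comp_complFibOn {S : Set B} {b : B} (hb : b ∈ S) :
    (complProjOn F E S).comp (complFibOn hb) = ContinuousMap.const _ (⟨b, hb⟩ : ↥S) := rfl

variable {F E} in
/-- Restriction commutes with the projections. [folklore] -/
theorem complProjOn_comp_complPreimageIncl {S' S : Set B} (h : S' ⊆ S) :
    (complProjOn F E S).comp (complPreimageIncl (F := F) (E := E) h) =
      (ContinuousMap.mk (Set.inclusion h) (continuous_inclusion h)).comp (complProjOn F E S') := rfl

variable {F E} in
/-- Restriction commutes with the sections at infinity. [folklore] -/
theorem complPreimageIncl_comp_complInfOn {S' S : Set B} (h : S' ⊆ S) :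
    (complPreimageIncl (F := F) (E := E) h).comp (complInfOn F E hF S') =
      (complInfOn F E hF S).comp (ContinuousMap.mk (Set.inclusion h) (continuous_inclusion h)) := rfl

variable {F E} in
/-- Restriction commutes with the fibres. [folklore] -/
theorem complPreimageIncl_comp_complFibOn {S' S : Set B} (h : S' ⊆ S) {b : B} (hb : b ∈ S') :
    (complPreimageIncl (F := F) (E := E) h).comp (complFibOn hb) = complFibOn (h hb) := rfl

/-! ### Renormalisation -/

variable {F E}

/-- **Renormalisation** `x ↦ x − π^*(s_∞^* x)`. [cite: MilnorStasheff1974, §10] -/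
def renormalise (S : Set B) (x : singularCohomology R R ↥(complPreimage F E S) 2) :
    singularCohomology R R ↥(complPreimage F E S) 2 :=
  x - singularCohomology.map R R (complProjOn F E S) 2 (singularCohomology.map R R (complInfOn F E hF S) 2 x)

/-- **A class with the canonical fibre restrictions becomes normalised after renormalisation**
(`s_∞^*` of it is `s^*x − (π s)^* s^* x = 0`; a fibre restriction of `π^* y` factors through a point).
[cite: MilnorStasheff1974, §10] -/
theorem isNormalised_renormalise {S : Set B} {m : R} {x : singularCohomology R R ↥(complPreimage F E S) 2}
    (hfib : ∀ (b : B) (hb : b ∈ S), singularCohomology.map R R (complFibOn hb) 2 x = omegaFib F E hF R R b m) :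
    IsNormalised F E hF R R S m (renormalise hF R S x) where
  map_complInfOn := by
    rw [renormalise, map_sub, ← ModuleCat.comp_apply (singularCohomology.map R R (complProjOn F E S) 2),
      ← singularCohomology.map_comp, complProjOn_comp_complInfOn, singularCohomology.map_id, ModuleCat.id_apply,
      sub_self]
  map_complFibOn b hb := by
    rw [renormalise, map_sub, hfib b hb, ← ModuleCat.comp_apply (singularCohomology.map R R (complProjOn F E S) 2),
      ← singularCohomology.map_comp, complProjOn_comp_complFibOn,
      singularCohomology.map_const_eq_zero R R _ two_ne_zero, sub_zero]

/-- **Renormalisation does not change a class where it is already normalised.** [folklore] -/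
theorem map_complPreimageIncl_renormalise {S' S : Set B} (h : S' ⊆ S) {m : R}
    {x : singularCohomology R R ↥(complPreimage F E S) 2}
    (hx : IsNormalised F E hF R R S' m (singularCohomology.map R R (complPreimageIncl h) 2 x)) :
    singularCohomology.map R R (complPreimageIncl h) 2 (renormalise hF R S x) =
      singularCohomology.map R R (complPreimageIncl h) 2 x := by
  rw [renormalise, map_sub, sub_eq_self, ← ModuleCat.comp_apply, ← singularCohomology.map_comp,
    complProjOn_comp_complPreimageIncl, singularCohomology.map_comp, ModuleCat.comp_apply,
    ← ModuleCat.comp_apply (singularCohomology.map R R (complInfOn F E hF S) 2), ← singularCohomology.map_comp,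
    ← complPreimageIncl_comp_complInfOn hF h, singularCohomology.map_comp, ModuleCat.comp_apply, hx.map_complInfOn,
    map_zero]

/-! ### Uniqueness domains -/

variable (F E)

/-- **`S` is a uniqueness domain**: two normalised classes over `S` (same generator) coincide. [folklore] -/
def IsUniq (S : Set B) : Prop :=
  ∀ (m : R) (x x' : singularCohomology R R ↥(complPreimage F E S) 2),
    IsNormalised F E hF R R S m x → IsNormalised F E hF R R S m x' → x = x'

variable {F E}

/-- **Trivialisable sets are uniqueness domains** (`LineThomClassLocal.IsNormalised.unique`).
[cite: MilnorStasheff1974, §10 Thm. 10.4] -/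
theorem isUniq_of_subset_baseSet (e : Trivialization F (π F E)) [MemTrivializationAtlas e] {S : Set B}
    (hS : S ⊆ e.baseSet) : IsUniq F E hF R S :=
  fun _ _ _ hx hx' ↦ hx.unique hF e hS hx'

/-! ### Pieces of `P(λ ⊕ ℂ)|_T` over a partition of `T` -/

variable (F E)

/-- The piece of `P(λ ⊕ ℂ)|_T` over `S ⊆ T`, as a subset. [folklore] -/
def complPiece (T S : Set B) : Set ↥(complPreimage F E T) := {p | p.1.proj ∈ S}

/-- `P(λ ⊕ ℂ)|_S ≃ₜ` the piece over `S ⊆ T`. [folklore] -/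
def complPieceHomeomorph {T S : Set B} (h : S ⊆ T) : ↥(complPreimage F E S) ≃ₜ ↥(complPiece F E T S) where
  toFun p := ⟨⟨p.1, h p.2⟩, p.2⟩
  invFun q := ⟨q.1.1, q.2⟩
  left_inv _ := rfl
  right_inv _ := rfl
  continuous_toFun := (continuous_subtype_val.subtype_mk _).subtype_mk _
  continuous_invFun := (continuous_subtype_val.comp continuous_subtype_val).subtype_mk _

/-- The identification is compatible with the inclusions. [folklore] -/
theorem subsetIncl_comp_complPieceHomeomorph {T S : Set B} (h : S ⊆ T) :
    (subsetIncl (complPiece F E T S)).comp (complPieceHomeomorph F E h : C(_, _)) = complPreimageIncl h := rfl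

/-- The piece of the base `↥T` over `S ⊆ T`. [folklore] -/
def basePiece (T S : Set B) : Set ↥T := Subtype.val ⁻¹' S

/-- `↥S ≃ₜ` the piece of `↥T` over `S ⊆ T`. [folklore] -/
def basePieceHomeomorph {T S : Set B} (h : S ⊆ T) : ↥S ≃ₜ ↥(basePiece T S) where
  toFun b := ⟨⟨b.1, h b.2⟩, b.2⟩
  invFun c := ⟨c.1.1, c.2⟩
  left_inv _ := rfl
  right_inv _ := rfl
  continuous_toFun := (continuous_subtype_val.subtype_mk _).subtype_mk _
  continuous_invFun := (continuous_subtype_val.comp continuous_subtype_val).subtype_mk _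

/-- The identification is compatible with the inclusions. [folklore] -/
theorem subsetIncl_comp_basePieceHomeomorph {T S : Set B} (h : S ⊆ T) :
    (subsetIncl (basePiece T S)).comp (basePieceHomeomorph h : C(_, _)) =
      ContinuousMap.mk (Set.inclusion h) (continuous_inclusion h) := rfl

variable {J : Type*} {S : J → Set B} (hSo : ∀ j, IsOpen (S j)) (hdisj : Pairwise (Disjoint on S))
include hSo hdisj

/-- Over a pairwise disjoint open family, the pieces of `P(λ ⊕ ℂ)|_{⋃ S_j}` form a clopen partition. [folklore] -/
theorem isClopenPartition_complPiece :
    IsClopenPartition fun j ↦ complPiece F E (⋃ j, S j) (S j) :=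
  IsClopenPartition.of_pairwise_disjoint
    (fun j ↦ (hSo j).preimage ((complProj F E).continuous.comp continuous_subtype_val))
    (fun i j hij ↦ Set.disjoint_left.2 fun p hi hj ↦ Set.disjoint_left.1 (hdisj hij) hi hj)
    (eq_univ_of_forall fun p ↦ by
      obtain ⟨j, hj⟩ := mem_iUnion.1 (show p.1.proj ∈ ⋃ j, S j from p.2)
      exact mem_iUnion.2 ⟨j, hj⟩)

/-- Over a pairwise disjoint open family, the pieces of `↥(⋃ S_j)` form a clopen partition. [folklore] -/
theorem isClopenPartition_basePiece :
    IsClopenPartition fun j ↦ basePiece (⋃ j, S j) (S j) :=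
  IsClopenPartition.of_pairwise_disjoint (fun j ↦ (hSo j).preimage continuous_subtype_val)
    (fun i j hij ↦ Set.disjoint_left.2 fun p hi hj ↦ Set.disjoint_left.1 (hdisj hij) hi hj)
    (eq_univ_of_forall fun p ↦ by
      obtain ⟨j, hj⟩ := mem_iUnion.1 (show p.1 ∈ ⋃ j, S j from p.2)
      exact mem_iUnion.2 ⟨j, hj⟩)

/-- **Disjoint open unions of uniqueness domains are uniqueness domains.** [folklore] -/
theorem isUniq_iUnion (huniq : ∀ j, IsUniq F E hF R (S j)) : IsUniq F E hF R (⋃ j, S j) := by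
  intro m x x' hx hx'
  rw [← sub_eq_zero]
  refine eq_zero_of_forall_map_piece_eq_zero R R (isClopenPartition_complPiece F E hSo hdisj)
    (fun j ↦ complPieceHomeomorph F E (subset_iUnion S j)) (fun j ↦ complPreimageIncl (subset_iUnion S j))
    (fun j ↦ rfl) fun j ↦ ?_
  rw [map_sub, sub_eq_zero]
  exact huniq j m _ _ (hx.restrict hF (subset_iUnion S j)) (hx'.restrict hF (subset_iUnion S j))

/-- **Normalised classes over pairwise disjoint open sets assemble** to a normalised class over the
union, restricting to the given ones. [cite: HatcherAT2002, §3.1 p. 202] -/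
theorem exists_isNormalised_iUnion {m : R} (x : ∀ j, singularCohomology R R ↥(complPreimage F E (S j)) 2)
    (hx : ∀ j, IsNormalised F E hF R R (S j) m (x j)) :
    ∃ y : singularCohomology R R ↥(complPreimage F E (⋃ j, S j)) 2,
      IsNormalised F E hF R R (⋃ j, S j) m y ∧
        ∀ j, singularCohomology.map R R (complPreimageIncl (subset_iUnion S j)) 2 y = x j := by
  obtain ⟨y, hy⟩ := exists_forall_map_piece_eq R R (isClopenPartition_complPiece F E hSo hdisj)
    (fun j ↦ complPieceHomeomorph F E (subset_iUnion S j)) (fun j ↦ complPreimageIncl (subset_iUnion S j))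
    (fun j ↦ rfl) x
  refine ⟨y, ⟨?_, fun b hb ↦ ?_⟩, hy⟩
  · -- `s_∞^* y` vanishes on every piece `↥(S j)` of the base
    refine eq_zero_of_forall_map_piece_eq_zero R R (isClopenPartition_basePiece hSo hdisj)
      (fun j ↦ basePieceHomeomorph (subset_iUnion S j))
      (fun j ↦ ContinuousMap.mk (Set.inclusion (subset_iUnion S j)) (continuous_inclusion _)) (fun j ↦ rfl) fun j ↦ ?_
    rw [← ModuleCat.comp_apply, ← singularCohomology.map_comp, ← complPreimageIncl_comp_complInfOn hF,
      singularCohomology.map_comp, ModuleCat.comp_apply, hy j, (hx j).map_complInfOn]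
  · obtain ⟨j, hj⟩ := mem_iUnion.1 hb
    rw [← complPreimageIncl_comp_complFibOn (subset_iUnion S j) hj, singularCohomology.map_comp,
      ModuleCat.comp_apply, hy j, (hx j).map_complFibOn b hj]

/-! ### Two-piece gluing (Mayer–Vietoris) -/

omit hSo hdisj in
/-- **Gluing two normalised classes**: over open `S₁`, `S₂` with `S₁ ∩ S₂` a uniqueness domain,
normalised classes `x₁`, `x₂` are the restrictions of a normalised class over `S₁ ∪ S₂`
(Mayer–Vietoris gluing of `x₁`, `x₂` — they agree over `S₁ ∩ S₂` by uniqueness — followed by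
renormalisation, which does not alter the restrictions). [cite: MilnorStasheff1974, §10 Thm. 10.4] -/
theorem exists_isNormalised_union {S₁ S₂ : Set B} (h₁ : IsOpen S₁) (h₂ : IsOpen S₂)
    (huniq : IsUniq F E hF R (S₁ ∩ S₂)) {m : R}
    {x₁ : singularCohomology R R ↥(complPreimage F E S₁) 2} {x₂ : singularCohomology R R ↥(complPreimage F E S₂) 2}
    (hx₁ : IsNormalised F E hF R R S₁ m x₁) (hx₂ : IsNormalised F E hF R R S₂ m x₂) :
    ∃ x : singularCohomology R R ↥(complPreimage F E (S₁ ∪ S₂)) 2,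
      IsNormalised F E hF R R (S₁ ∪ S₂) m x ∧
        singularCohomology.map R R (complPreimageIncl subset_union_left) 2 x = x₁ ∧
          singularCohomology.map R R (complPreimageIncl subset_union_right) 2 x = x₂ := by
  -- the two open pieces of `X = P(λ ⊕ ℂ)|_{S₁ ∪ S₂}`
  set T : Set B := S₁ ∪ S₂ with hT
  have hπ : Continuous fun p : ↥(complPreimage F E T) ↦ p.1.proj :=
    (complProj F E).continuous.comp continuous_subtype_val
  have hA₁ : IsOpen (complPiece F E T S₁) := h₁.preimage hπ
  have hA₂ : IsOpen (complPiece F E T S₂) := h₂.preimage hπ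
  have hcov : complPiece F E T S₁ ∪ complPiece F E T S₂ = univ := eq_univ_of_forall fun p ↦ p.2
  set θ₁ := complPieceHomeomorph F E (subset_union_left : S₁ ⊆ T) with hθ₁
  set θ₂ := complPieceHomeomorph F E (subset_union_right : S₂ ⊆ T) with hθ₂
  -- the overlap piece is `P(λ ⊕ ℂ)|_{S₁ ∩ S₂}`
  let θ₁₂ : ↥(complPreimage F E (S₁ ∩ S₂)) ≃ₜ ↥(complPiece F E T S₁ ∩ complPiece F E T S₂) :=
    complPieceHomeomorph F E (inter_subset_left.trans (subset_union_left : S₁ ⊆ T))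
  set a := singularCohomology.map R R (θ₁.symm : C(↥(complPiece F E T S₁), ↥(complPreimage F E S₁))) 2 x₁ with ha
  set b := singularCohomology.map R R (θ₂.symm : C(↥(complPiece F E T S₂), ↥(complPreimage F E S₂))) 2 x₂ with hb
  -- they agree on the overlap, by uniqueness over `S₁ ∩ S₂`
  have e₁ : (θ₁.symm : C(↥(complPiece F E T S₁), ↥(complPreimage F E S₁))).comp
      (ContinuousMap.inclusion (inter_subset_left : complPiece F E T S₁ ∩ complPiece F E T S₂ ⊆ complPiece F E T S₁)) =
        (complPreimageIncl (inter_subset_left : S₁ ∩ S₂ ⊆ S₁)).comp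
          (θ₁₂.symm : C(↥(complPiece F E T S₁ ∩ complPiece F E T S₂), ↥(complPreimage F E (S₁ ∩ S₂)))) := rfl
  have e₂ : (θ₂.symm : C(↥(complPiece F E T S₂), ↥(complPreimage F E S₂))).comp
      (ContinuousMap.inclusion (inter_subset_right : complPiece F E T S₁ ∩ complPiece F E T S₂ ⊆ complPiece F E T S₂)) =
        (complPreimageIncl (inter_subset_right : S₁ ∩ S₂ ⊆ S₂)).comp
          (θ₁₂.symm : C(↥(complPiece F E T S₁ ∩ complPiece F E T S₂), ↥(complPreimage F E (S₁ ∩ S₂)))) := rfl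
  have hab : singularCohomology.map R R (ContinuousMap.inclusion
      (inter_subset_left : complPiece F E T S₁ ∩ complPiece F E T S₂ ⊆ complPiece F E T S₁)) 2 a =
        singularCohomology.map R R (ContinuousMap.inclusion
      (inter_subset_right : complPiece F E T S₁ ∩ complPiece F E T S₂ ⊆ complPiece F E T S₂)) 2 b := by
    rw [ha, hb, ← ModuleCat.comp_apply, ← singularCohomology.map_comp, e₁, ← ModuleCat.comp_apply,
      ← singularCohomology.map_comp, e₂, singularCohomology.map_comp, singularCohomology.map_comp,
      ModuleCat.comp_apply, ModuleCat.comp_apply,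
      huniq m _ _ (hx₁.restrict hF inter_subset_left) (hx₂.restrict hF inter_subset_right)]
  -- Mayer–Vietoris gluing
  obtain ⟨c, hc₁, hc₂⟩ := singularCohomology.exists_of_map_inclusion_eq R hA₁ hA₂ hcov a b hab
  have hr₁ : singularCohomology.map R R (complPreimageIncl (subset_union_left : S₁ ⊆ T)) 2 c = x₁ := by
    rw [← subsetIncl_comp_complPieceHomeomorph F E (subset_union_left : S₁ ⊆ T), singularCohomology.map_comp,
      ModuleCat.comp_apply, ← hθ₁, hc₁, ha, ← ModuleCat.comp_apply, ← singularCohomology.map_comp,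
      Homeomorph.symm_comp_toContinuousMap, singularCohomology.map_id]
    rfl
  have hr₂ : singularCohomology.map R R (complPreimageIncl (subset_union_right : S₂ ⊆ T)) 2 c = x₂ := by
    rw [← subsetIncl_comp_complPieceHomeomorph F E (subset_union_right : S₂ ⊆ T), singularCohomology.map_comp,
      ModuleCat.comp_apply, ← hθ₂, hc₂, hb, ← ModuleCat.comp_apply, ← singularCohomology.map_comp,
      Homeomorph.symm_comp_toContinuousMap, singularCohomology.map_id]
    rfl
  -- the glued class has the canonical fibre restrictions; renormalise it
  have hfib : ∀ (b : B) (hb : b ∈ T), singularCohomology.map R R (complFibOn hb) 2 c = omegaFib F E hF R R b m := by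
    intro b hb
    rcases hb with hb | hb
    · rw [← complPreimageIncl_comp_complFibOn (subset_union_left : S₁ ⊆ T) hb, singularCohomology.map_comp,
        ModuleCat.comp_apply, hr₁, hx₁.map_complFibOn b hb]
    · rw [← complPreimageIncl_comp_complFibOn (subset_union_right : S₂ ⊆ T) hb, singularCohomology.map_comp,
        ModuleCat.comp_apply, hr₂, hx₂.map_complFibOn b hb]
  refine ⟨renormalise hF R T c, isNormalised_renormalise hF R hfib, ?_, ?_⟩
  · rw [map_complPreimageIncl_renormalise hF R subset_union_left (by rw [hr₁]; exact hx₁), hr₁]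
  · rw [map_complPreimageIncl_renormalise hF R subset_union_right (by rw [hr₂]; exact hx₂), hr₂]

end Setting

end Literature.AlgebraicTopology.CharacteristicClasses
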